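import Literature.Geometry.Symplectic.GirouxContactPathNbhd
import Mathlib.Topology.Instances.AddCircle.Real
import HarnessLib

/-!
# Cutting off a circle-valued map inside a binding tube of an open book

Topic `Literature/Geometry/Symplectic`; an API file for the open books `OpenBook M` of
`PlanarContactBoundary.lean` and their tubes (`GirouxContactPathNbhd.lean`: `tubeSet`, `tubeSetC`,
`rhoN`, the transition `profS`).  Setting of the Legendrian-realisation step of
`Literature.Geometry.Symplectic.palf_stein_supportedByBoundaryOpenBook` (its brick
`LegendrianRealisationOnPage.lean` wants the dual closed `1`-form `η` of the page curve to VANISH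
on tubes around the binding): the form is `η = dφ` for a circle-valued map `φ : M → ℝ/ℤ` with
smooth local real lifts (`Literature/Geometry/Manifold/CircleMapForm.lean`), and where `φ` admits
a smooth real lift `L` on a whole tube `tubeSet i ε` (equivalently: `dφ` is exact there; for the
Lefschetz base, the binding bounds a page so its winding vanishes) one replaces `φ` inside the
tube by `S(r²) · L mod 1`, `S` the smooth transition with `S = 0` for `r² ≤ ε²/8`, `S = 1` for
`r² ≥ ε²/4`:

* `OpenBook.circleCutoff` — the modified map `φ'`;
* `OpenBook.circleCutoff_eq_of_not_mem` — `φ' = φ` off the closed `ε/2`-tube;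
* `OpenBook.circleCutoff_eq_zero` — `φ' = 0` on the open `ε/3`-tube;
* **`OpenBook.circleCutoff_smooth_lifts`** — `φ'` again has smooth local real lifts (so `dφ'` is
  a smooth closed `1`-form, equal to `dφ` off the `ε/2`-tube and to `0` on the `ε/3`-tube).

Bott–Tu 1982, §2 (a closed `1`-form that is exact on an open set can be cut off there without
changing it elsewhere); everything is proved, one definition, no named fact.

## References
* R. Bott, L. W. Tu, *Differential Forms in Algebraic Topology*, GTM 82 (1982), §2 Prop. 2.3.
  [BottTu1982Forms]
* J. B. Etnyre, *Lectures on open book decompositions and contact structures* (2006), proof of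
  Lemma 3.3 (the tubes `N = S¹ × D²` of the binding). [Etnyre2006]
-/

noncomputable section

open scoped Manifold ContDiff Topology
open Set Function Filter

namespace Literature.Geometry.Symplectic

/-- Local notation: `𝔼 n` is the model Euclidean space `EuclideanSpace ℝ (Fin n)`. -/
local notation "𝔼 " n:arg => EuclideanSpace ℝ (Fin n)

namespace OpenBook

variable {M : Type*} [TopologicalSpace M] [ChartedSpace (𝔼 3) M] [IsManifold (𝓡 3) ∞ M]
variable (ob : OpenBook M)

/-- **The cut-off circle map**: inside the open `ε`-tube, `S_{ε/2}(r²) · L mod 1`; outside, `φ`.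
[cite: BottTu1982Forms, §2 Prop. 2.3] -/
def circleCutoff (i : Fin ob.k) (ε : ℝ) (φ : M → UnitAddCircle) (L : M → ℝ) (y : M) :
    UnitAddCircle := by
  classical
  exact if y ∈ ob.tubeSet i ε then (((profS (ε / 2) (ob.rhoN i y) * L y : ℝ)) : UnitAddCircle)
    else φ y

variable {ob} {i : Fin ob.k} {ε : ℝ} {φ : M → UnitAddCircle} {L : M → ℝ}

/-- Inside the `ε`-tube the cut-off map is `S(r²) L mod 1`. [folklore] -/
theorem circleCutoff_of_mem {y : M} (hy : y ∈ ob.tubeSet i ε) :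
    ob.circleCutoff i ε φ L y = (((profS (ε / 2) (ob.rhoN i y) * L y : ℝ)) : UnitAddCircle) := by
  classical
  exact if_pos hy

/-- Outside the `ε`-tube the cut-off map is `φ`. [folklore] -/
theorem circleCutoff_of_not_mem {y : M} (hy : y ∉ ob.tubeSet i ε) :
    ob.circleCutoff i ε φ L y = φ y := by
  classical
  exact if_neg hy

/-- **Off the closed `ε/2`-tube, `φ' = φ`** (there `S = 1` and `L` lifts `φ`).
[cite: BottTu1982Forms, §2 Prop. 2.3] -/
theorem circleCutoff_eq_of_not_mem (hε : 0 < ε) (hLφ : ∀ q ∈ ob.tubeSet i ε, φ q = ((L q : ℝ) : UnitAddCircle))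
    {y : M} (hy : y ∉ ob.tubeSetC i (ε / 2)) : ob.circleCutoff i ε φ L y = φ y := by
  by_cases hyt : y ∈ ob.tubeSet i ε
  · rw [circleCutoff_of_mem hyt]
    have h1 : (ε / 2) ^ 2 < ob.rhoN i y :=
      ob.sq_lt_rhoN_of_not_mem_tubeSetC i (by positivity) (ob.tubeSet_subset_range i ε hyt) hy
    rw [profS_eq_one (half_pos hε) h1.le, one_mul, hLφ y hyt]
  · exact circleCutoff_of_not_mem hyt

/-- **On the open `ε/3`-tube, `φ' = 0`** (there `S = 0`). [cite: BottTu1982Forms, §2 Prop. 2.3] -/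
theorem circleCutoff_eq_zero (hε : 0 < ε) {y : M} (hy : y ∈ ob.tubeSet i (ε / 3)) :
    ob.circleCutoff i ε φ L y = 0 := by
  have hyt : y ∈ ob.tubeSet i ε := ob.tubeSet_mono i (by linarith) hy
  rw [circleCutoff_of_mem hyt]
  have h1 : ob.rhoN i y < (ε / 3) ^ 2 := ob.rhoN_lt_of_mem_tubeSet i hy
  have h2 : ob.rhoN i y ≤ (ε / 2) ^ 2 / 2 := by nlinarith
  rw [profS_eq_zero (half_pos hε) h2, zero_mul]
  rfl

/-- The lift `S(r²) · L` used inside the tube is smooth at the points of the tube where `L` is.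
[folklore] -/
theorem contMDiffAt_profS_rhoN_mul {y : M} (hy : y ∈ ob.tubeSet i ε)
    (hL : ContMDiffAt (𝓡 3) 𝓘(ℝ, ℝ) ∞ L y) :
    ContMDiffAt (𝓡 3) 𝓘(ℝ, ℝ) ∞ (fun q => profS (ε / 2) (ob.rhoN i q) * L q) y :=
  (contDiff_profS.contDiffAt.contMDiffAt.comp y
    (ob.contMDiffAt_rhoN i (ob.tubeSet_subset_range i ε hy))).mul hL

/-- **The cut-off map has smooth local real lifts** if `φ` has and `L` is a smooth lift of `φ` on
the `ε`-tube: inside the tube the lift is `S(r²) L`, off the closed `ε/2`-tube it is any lift of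
`φ`. [cite: BottTu1982Forms, §2 Prop. 2.3] -/
theorem circleCutoff_smooth_lifts [T2Space M] (hε : 0 < ε)
    (hφ : ∀ p, ∃ (W : Set M) (F : M → ℝ), IsOpen W ∧ p ∈ W ∧
      (∀ q ∈ W, ContMDiffAt (𝓡 3) 𝓘(ℝ, ℝ) ∞ F q) ∧ ∀ q ∈ W, φ q = ((F q : ℝ) : UnitAddCircle))
    (hL : ∀ q ∈ ob.tubeSet i ε, ContMDiffAt (𝓡 3) 𝓘(ℝ, ℝ) ∞ L q)
    (hLφ : ∀ q ∈ ob.tubeSet i ε, φ q = ((L q : ℝ) : UnitAddCircle)) (p : M) :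
    ∃ (W : Set M) (F : M → ℝ), IsOpen W ∧ p ∈ W ∧
      (∀ q ∈ W, ContMDiffAt (𝓡 3) 𝓘(ℝ, ℝ) ∞ F q) ∧
      ∀ q ∈ W, ob.circleCutoff i ε φ L q = ((F q : ℝ) : UnitAddCircle) := by
  by_cases hp : p ∈ ob.tubeSet i ε
  · refine ⟨ob.tubeSet i ε, fun q => profS (ε / 2) (ob.rhoN i q) * L q, ob.isOpen_tubeSet i ε, hp,
      fun q hq => contMDiffAt_profS_rhoN_mul hq (hL q hq), fun q hq => circleCutoff_of_mem hq⟩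
  · obtain ⟨W, F, hW, hpW, hF, hl⟩ := hφ p
    have hpC : p ∉ ob.tubeSetC i (ε / 2) := fun h =>
      hp (ob.tubeSetC_subset_tubeSet i (by linarith) h)
    refine ⟨W ∩ (ob.tubeSetC i (ε / 2))ᶜ, F, hW.inter (ob.isClosed_tubeSetC i _).isOpen_compl,
      ⟨hpW, hpC⟩, fun q hq => hF q hq.1, fun q hq => ?_⟩
    rw [circleCutoff_eq_of_not_mem hε hLφ hq.2]
    exact hl q hq.1

/-- **Composition with a loop off the tube is unchanged**: if a map `γ` avoids the closed
`ε/2`-tube then `φ' ∘ γ = φ ∘ γ` (so all windings / periods along such loops are unchanged).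
[folklore] -/
theorem circleCutoff_comp_eq {T : Type*} (hε : 0 < ε)
    (hLφ : ∀ q ∈ ob.tubeSet i ε, φ q = ((L q : ℝ) : UnitAddCircle)) {γ : T → M}
    (hγ : ∀ t, γ t ∉ ob.tubeSetC i (ε / 2)) :
    ob.circleCutoff i ε φ L ∘ γ = φ ∘ γ :=
  funext fun t => circleCutoff_eq_of_not_mem hε hLφ (hγ t)

end OpenBook

end Literature.Geometry.Symplectic
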